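import Summits.QuantumFields.YangMills.Theorems.UnitScaleTiltProp7TwistedOneStepDefectCovGauge
import Literature.MathematicalPhysics.QuantumFieldTheory.Balaban1983to89.T3PrintedRegularMinimiser
import Literature.MathematicalPhysics.QuantumFieldTheory.Balaban1983to89.T3SectALandauChart
import HarnessLib

/-!
# Route `UnitScaleTilt`, crux K1 «MinimiserStabilityRegPr» (stmt-QuantumFields-19200), route-R E′, ★★OWNER RULING g28-№13 (A′) HCOW-VIA-Σ, package P-A2 «JOINT-Σ», row F1″ —
# «F1″-COV AT THE MEMBER»: THE ONE-STEP COVARIANT DEFECT IN MASS CURRENCY ALONG THE AVERAGED BACKGROUND TOWER OF A PRINTED-REGULAR `U₀`, k-UNIFORM, L-ONLY CONSTANT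
# `Σ_{c : PBond (F.P K) (l+1)} ‖f_l(y)(c) − Df_l(0)·y (c)‖ ≤ 10⁹·L⁴·Σ_b ‖y b‖²` for `RegPr F n K ε₀ U₀`, `10⁷L³ε₀ ≤ 1`, `l + 1 ≤ K − n`, `‖y b‖ ≤ s`, `10⁵·L·s ≤ 1`

Cell `ym3-torus`, width seat `ym3-torus-px15` (gen 3); `--supports stmt-QuantumFields-19200 --as helper`, count-neutral; the MEMBER READING of routeR-w6 g7's generic F1″-COV row
✓`Prop7TwistedOneStepDefectCovGauge.sum_norm_chart_sub_fderiv_le_of_plaqSmall` (division «α» of 2026-08-29 02:26Z: generic core + cluster gauge = routeR-w6; member reading = this seat).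
YM₃ on T³ is a ladder rung (R3), not the Clay problem; nothing here claims a mass gap.

WHAT.  `f_l(y)(c) := log[(dbarCovU Ū₀ˡ (e^{y}Ū₀ˡ))(c)·(Ū₀^{l+1}(c))⁻¹]`, `Ū₀ˡ = emlIterU l U₀♭`, `U₀♭ = bgUnits F K U₀` (the (A′) tower's one-step map at level `l`, ✓`dbarCovIterU_succ`, in the
chart routeR-w6 inlines); the generic row bounds `Σ_c ‖f_l(y)(c) − fderiv f_l^c 0 y‖` by `(80B∕R²)·2d·Σ_b‖y b‖²` for a PLAQUETTE-small `SU(2)` background under two budgets in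
`(ℓ, Lˡ, s_B, R)`.  HERE: at a member `(F, n, K)` with `RegPr F n K ε₀ U₀` ([Balaban1985Variational] (2): `PlaqSmall (ε₀L^{−2(K−n)}) U₀`) and the ONE window `10⁷L³ε₀ ≤ 1`, for every
level `l + 1 ≤ K − n`: `s_B = 6(3L^{l+1} − 1)·ε₀L^{−2(K−n)}`, so `Lˡ·s_B ≤ 18ε₀∕L` (uses `L^{2l+2} ≤ L^{2(K−n)}`), both budgets hold with the Cauchy radius `R := (30000L)⁻¹`, and the constant is
`≤ 10⁹·L⁴` — k-UNIFORM and L-only, the `hr : r_l ≤ C_D·M_l` row of ✓`Prop7JointRowOfLevelMasses.jointRow_of_levelMasses` at the member (`C_D = 10⁹L⁴`).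
* §1 letter-free real lemmas: `pow_ratio_le_one`, `level_read_le` (`Lˡ·s_B ≤ 18ε₀∕L`), `budget_member`, `window_member`, `radius_member` (`2s < R`), `constant_member` (`80B∕R²·6 ≤ 10⁹L⁴`).
* §2 `member_rows` (standing range, radius, the two budgets VERBATIM, constant `≤ 10⁹L⁴` — from the one window); §3 ★★★ `sum_norm_chart_sub_fderiv_le_of_regPr` (the title) and its field-valued twin ★★★ `sum_norm_chartField_sub_fderiv_apply_le_of_regPr` (the letter F0″∕F4″ consume).
HONEST SCOPE: instantiation + numerals over routeR-w6's generic theorem; nothing displayed; no stub ∕ crux claimed.  Sorry-free, no `def`, no `instance`.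

References: T. Bałaban, CMP 102 (1985) 277–309 [Balaban1985Variational] ((2) p.278, (44)–(46) p.285, (146) p.301); CMP 98 (1985) 17–51 [Balaban1985Averaging] ((11)–(12) p.19, (89) p.31,
(121)–(125) p.36, (161)–(163) p.42).
-/

set_option autoImplicit false

noncomputable section

open scoped BigOperators Matrix.Norms.L2Operator
open NormedSpace Finset

namespace Summit.QuantumFields.YangMills.Theorems.Prop7TwistedOneStepDefectOfRegPr

open Literature.MathematicalPhysics.QuantumFieldTheory.Balaban1983to89
open Literature.MathematicalPhysics.QuantumFieldTheory.Balaban1983to89.T3ContinuumYM3Torus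
open T4Continuum BlockAveraging MatrixLog
open T3PrintedRegularMinimiser (RegPr)
open T3RegularMinimiser (regThreshold regThreshold_pos)
open T3SectALandauChart (pos_of_regPr bgUnits)
open B7Prop1Explicit (expUnit)
open B10Eq27TorusAxialLog (unitsField toUField)
open Summit.QuantumFields.YangMills.Theorems.Prop8Chart (emlAvgU emlIterU)
open Summit.QuantumFields.YangMills.Theorems.Prop7SymAvgTwSym (dbarCovU)
open Summit.QuantumFields.YangMills.Theorems.Prop7TwistedOneStepDefectCovGauge (sum_norm_chart_sub_fderiv_le_of_plaqSmall sum_norm_chartField_sub_fderiv_apply_le_of_plaqSmall)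

/-! ## §1 Letter-free numerals -/

/-- `L^{2l+2}·(L⁻¹)^{2k} ≤ 1` for `l + 1 ≤ k`, `1 ≤ L`. [folklore] -/
theorem pow_ratio_le_one {L : ℝ} (hL : 1 ≤ L) {l k : ℕ} (hl : l + 1 ≤ k) : L ^ (2 * l + 2) * L⁻¹ ^ (2 * k) ≤ 1 := by
  have hL0 : 0 < L := by linarith
  rw [inv_pow, ← div_eq_mul_inv, div_le_one (by positivity)]
  exact pow_le_pow_right₀ hL (by omega)

/-- **THE LEVEL READ IS k-UNIFORM**: `Lˡ·(2·(3·(3L^{l+1} − 1))·(ε₀(L⁻¹)^{2k})) ≤ 18ε₀∕L` for `l + 1 ≤ k`, `1 ≤ L`, `0 ≤ ε₀`. [cite: Balaban1985Variational, (146) p.301] -/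
theorem level_read_le {L ε₀ : ℝ} (hL : 1 ≤ L) (hε₀ : 0 ≤ ε₀) {l k : ℕ} (hl : l + 1 ≤ k) :
    L ^ l * (2 * (3 * (3 * L ^ (l + 1) - 1)) * (ε₀ * L⁻¹ ^ (2 * k))) ≤ 18 * ε₀ / L := by
  have hL0 : 0 < L := by linarith
  have hr := pow_ratio_le_one hL hl
  have h1 : L ^ l * (2 * (3 * (3 * L ^ (l + 1) - 1)) * (ε₀ * L⁻¹ ^ (2 * k))) ≤ L ^ l * (2 * (3 * (3 * L ^ (l + 1))) * (ε₀ * L⁻¹ ^ (2 * k))) := by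
    have : (0 : ℝ) ≤ L ^ l := by positivity
    have : (0 : ℝ) ≤ ε₀ * L⁻¹ ^ (2 * k) := by positivity
    gcongr
    linarith
  have h2 : L ^ l * (2 * (3 * (3 * L ^ (l + 1))) * (ε₀ * L⁻¹ ^ (2 * k))) = 18 * ε₀ / L * (L ^ (2 * l + 2) * L⁻¹ ^ (2 * k)) := by
    have : L ^ (2 * l + 2) = L ^ l * L ^ (l + 1) * L := by ring
    rw [this]
    field_simp
    ring
  rw [h2] at h1
  exact h1.trans (mul_le_of_le_one_right (by positivity) hr)

/-- the first budget at the member: `6400·(5L)²·p ≤ 1` for `p ≤ 18ε₀∕L`, `10⁷L³ε₀ ≤ 1`, `L ≥ 3`. [cite: Balaban1985Variational, (146) p.301] -/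
theorem budget_member {L ε₀ p : ℝ} (hL : 3 ≤ L) (hε₀ : 0 ≤ ε₀) (hε : 10 ^ 7 * L ^ 3 * ε₀ ≤ 1) (hp0 : 0 ≤ p) (hp : p ≤ 18 * ε₀ / L) :
    6400 * (5 * L) ^ 2 * p ≤ 1 := by
  have hL0 : 0 < L := by linarith
  have h1 : 6400 * (5 * L) ^ 2 * p ≤ 6400 * (5 * L) ^ 2 * (18 * ε₀ / L) := mul_le_mul_of_nonneg_left hp (by positivity)
  have h2 : 6400 * (5 * L) ^ 2 * (18 * ε₀ / L) = 2880000 * L * ε₀ := by field_simp; ring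
  have h3 : 2880000 * L * ε₀ ≤ 10 ^ 7 * L ^ 3 * ε₀ := by
    have : L ≤ L ^ 3 := by nlinarith
    nlinarith
  linarith

/-- the second budget (the Cauchy window) at the member: `1000·5L·(2·(30·5L·p) + 3R) ≤ 1` at `R = (30000L)⁻¹` for `p ≤ 18ε₀∕L`, `10⁷L³ε₀ ≤ 1`, `L ≥ 3`.
[cite: Balaban1985Variational, (146) p.301] -/
theorem window_member {L ε₀ p : ℝ} (hL : 3 ≤ L) (hε₀ : 0 ≤ ε₀) (hε : 10 ^ 7 * L ^ 3 * ε₀ ≤ 1) (hp : p ≤ 18 * ε₀ / L) :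
    1000 * (5 * L) * (2 * (30 * (5 * L) * p) + 3 * (30000 * L)⁻¹) ≤ 1 := by
  have hL0 : 0 < L := by linarith
  have hq : 30 * (5 * L) * p ≤ 2700 * ε₀ := by
    have := mul_le_mul_of_nonneg_left hp (by positivity : (0 : ℝ) ≤ 30 * (5 * L))
    have e : 30 * (5 * L) * (18 * ε₀ / L) = 2700 * ε₀ := by field_simp; ring
    linarith
  have h3 : 1000 * (5 * L) * (3 * (30000 * L)⁻¹) = 1 / 2 := by field_simp; ring
  have h4 : 1000 * (5 * L) * (2 * (30 * (5 * L) * p)) ≤ 27000000 * L * ε₀ := by nlinarith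
  have h5 : 27000000 * L * ε₀ ≤ 3 / 10 := by
    have h9 : 9 ≤ L ^ 2 := by nlinarith
    have hL3' : 9 * L ≤ L ^ 3 := by nlinarith [h9, hL0]
    have : 9 * L * ε₀ ≤ L ^ 3 * ε₀ := mul_le_mul_of_nonneg_right hL3' hε₀
    nlinarith
  nlinarith

/-- the radius clause: `2s < (30000L)⁻¹` for `10⁵·L·s ≤ 1`, `0 < L`. [folklore] -/
theorem radius_member {L s : ℝ} (hL : 0 < L) (hsL : 100000 * L * s ≤ 1) : 2 * s < (30000 * L)⁻¹ := by
  rw [inv_eq_one_div, lt_div_iff₀ (by positivity)]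
  nlinarith

/-- the constant at the member: with `R = (30000L)⁻¹`, `q ≤ 2700ε₀`, `10⁷L³ε₀ ≤ 1`, `L ≥ 3`:
`80·(L·3R + 22100·(5L)²·(q + (q + 3R))²)∕R²·6 ≤ 10⁹·L⁴`. [cite: Balaban1985Variational, (146) p.301] -/
theorem constant_member {L ε₀ q : ℝ} (hL : 3 ≤ L) (hε₀ : 0 ≤ ε₀) (hε : 10 ^ 7 * L ^ 3 * ε₀ ≤ 1) (hq0 : 0 ≤ q) (hq : q ≤ 2700 * ε₀) :
    80 * (L * (3 * (30000 * L)⁻¹) + 22100 * (5 * L) ^ 2 * (q + (q + 3 * (30000 * L)⁻¹)) ^ 2) / ((30000 * L)⁻¹) ^ 2 * (2 * 3)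
      ≤ 10 ^ 9 * L ^ 4 := by
  have hL0 : 0 < L := by linarith
  -- `q ≤ 10⁻⁵`, `3R ≤ 10⁻⁴∕3`
  have hq1 : q ≤ 1 / 100000 := by
    have h9 : 9 ≤ L ^ 2 := by nlinarith
    have h27 : 27 ≤ L ^ 3 := by nlinarith [h9, hL0]
    have : 27 * ε₀ ≤ L ^ 3 * ε₀ := mul_le_mul_of_nonneg_right h27 hε₀
    nlinarith
  have hR3 : 3 * (30000 * L)⁻¹ ≤ 1 / 30000 := by
    rw [inv_eq_one_div]
    rw [show 3 * (1 / (30000 * L)) = 1 / (10000 * L) by field_simp; ring]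
    rw [div_le_div_iff₀ (by positivity) (by norm_num)]
    nlinarith
  have hR30 : 0 ≤ 3 * (30000 * L)⁻¹ := by positivity
  have hsum : q + (q + 3 * (30000 * L)⁻¹) ≤ 27 / 500000 := by linarith
  have hsum0 : 0 ≤ q + (q + 3 * (30000 * L)⁻¹) := by positivity
  have hsq : (q + (q + 3 * (30000 * L)⁻¹)) ^ 2 ≤ (27 / 500000) ^ 2 := pow_le_pow_left₀ hsum0 hsum 2
  have hLR : L * (3 * (30000 * L)⁻¹) = 1 / 10000 := by field_simp; ring
  -- the bracket `B ≤ 10⁻⁴ + 552500L²·(27∕500000)²`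
  have hB : L * (3 * (30000 * L)⁻¹) + 22100 * (5 * L) ^ 2 * (q + (q + 3 * (30000 * L)⁻¹)) ^ 2
      ≤ 1 / 10000 + 552500 * L ^ 2 * (27 / 500000) ^ 2 := by
    rw [hLR]
    have : 22100 * (5 * L) ^ 2 * (q + (q + 3 * (30000 * L)⁻¹)) ^ 2 ≤ 22100 * (5 * L) ^ 2 * (27 / 500000) ^ 2 :=
      mul_le_mul_of_nonneg_left hsq (by positivity)
    nlinarith
  have hB0 : 0 ≤ L * (3 * (30000 * L)⁻¹) + 22100 * (5 * L) ^ 2 * (q + (q + 3 * (30000 * L)⁻¹)) ^ 2 := by positivity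
  -- divide by `R²`: multiply by `(30000L)²`
  have hdiv : ∀ B : ℝ, 80 * B / ((30000 * L)⁻¹) ^ 2 * (2 * 3) = 480 * (30000 * L) ^ 2 * B := by
    intro B
    rw [inv_pow, div_inv_eq_mul]
    ring
  rw [hdiv]
  have h9 : (9 : ℝ) ≤ L ^ 2 := by nlinarith
  calc 480 * (30000 * L) ^ 2 * (L * (3 * (30000 * L)⁻¹) + 22100 * (5 * L) ^ 2 * (q + (q + 3 * (30000 * L)⁻¹)) ^ 2)
      ≤ 480 * (30000 * L) ^ 2 * (1 / 10000 + 552500 * L ^ 2 * (27 / 500000) ^ 2) :=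
        mul_le_mul_of_nonneg_left hB (by positivity)
    _ ≤ 10 ^ 9 * L ^ 4 := by nlinarith [h9, pow_nonneg hL0.le 2, pow_nonneg hL0.le 4]

/-! ## §2 The member's budgets, radius and constant (all from the one window) -/

variable (F : T3Family) (n K : ℕ)
variable {F n K}

/-- **THE MEMBER ROWS OF routeR-w6's GENERIC F1″-COV THEOREM**: at `P := F.P K`, `a₀ := regThreshold F n K ε₀ = ε₀L^{−2(K−n)}`, `R := (30000L)⁻¹`, for `RegPr F n K ε₀ U₀`,
`10⁷L³ε₀ ≤ 1`, `l + 1 ≤ K − n`, `10⁵·L·s ≤ 1`: the standing range `l + 2 ≤ m + K`, `0 < a₀`, `0 < R`, `2s < R`, the two budgets VERBATIM, and the constant `≤ 10⁹·L⁴`.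
[cite: Balaban1985Variational, (2) p.278, (146) p.301] -/
theorem member_rows {ε₀ : ℝ} (hε : 10 ^ 7 * (F.L : ℝ) ^ 3 * ε₀ ≤ 1)
    {U₀ : GaugeField (F.P K) 0 (Matrix.specialUnitaryGroup (Fin 2) ℂ)} (hreg : RegPr F n K ε₀ U₀) {l : ℕ} (hl : l + 1 ≤ K - n)
    {s : ℝ} (hsL : 100000 * (F.L : ℝ) * s ≤ 1) :
    l + 2 ≤ (F.P K).m + (F.P K).K ∧ 0 < regThreshold F n K ε₀ ∧ 0 < (30000 * (F.L : ℝ))⁻¹ ∧ 2 * s < (30000 * (F.L : ℝ))⁻¹ ∧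
    6400 * ((((F.P K).d + 2) * (F.P K).L : ℕ) : ℝ) ^ 2 * ((F.P K).L : ℝ) ^ l *
        (2 * (((F.P K).d : ℝ) * (3 * ((F.P K).L : ℝ) ^ (l + 1) - 1)) * regThreshold F n K ε₀) ≤ 1 ∧
    1000 * ((((F.P K).d + 2) * (F.P K).L : ℕ) : ℝ) *
        (2 * (30 * ((((F.P K).d + 2) * (F.P K).L : ℕ) : ℝ) * ((F.P K).L : ℝ) ^ l *
          (2 * (((F.P K).d : ℝ) * (3 * ((F.P K).L : ℝ) ^ (l + 1) - 1)) * regThreshold F n K ε₀)) + 3 * (30000 * (F.L : ℝ))⁻¹) ≤ 1 ∧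
    80 * (((F.P K).L : ℝ) * (3 * (30000 * (F.L : ℝ))⁻¹) + 22100 * ((((F.P K).d + 2) * (F.P K).L : ℕ) : ℝ) ^ 2 *
          ((30 * ((((F.P K).d + 2) * (F.P K).L : ℕ) : ℝ) * ((F.P K).L : ℝ) ^ l * (2 * (((F.P K).d : ℝ) * (3 * ((F.P K).L : ℝ) ^ (l + 1) - 1)) * regThreshold F n K ε₀)) +
            ((30 * ((((F.P K).d + 2) * (F.P K).L : ℕ) : ℝ) * ((F.P K).L : ℝ) ^ l * (2 * (((F.P K).d : ℝ) * (3 * ((F.P K).L : ℝ) ^ (l + 1) - 1)) * regThreshold F n K ε₀)) +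
              3 * (30000 * (F.L : ℝ))⁻¹)) ^ 2) / ((30000 * (F.L : ℝ))⁻¹) ^ 2 * (2 * ((F.P K).d : ℝ))
      ≤ 10 ^ 9 * (F.L : ℝ) ^ 4 := by
  have hε₀ : 0 < ε₀ := pos_of_regPr F hreg
  have hL3 : (3 : ℝ) ≤ F.L := by
    have : 3 ≤ F.L := by obtain ⟨a, ha⟩ := F.hL.1; have := F.hL.2; omega
    exact_mod_cast this
  have hL1 : (1 : ℝ) ≤ F.L := by linarith
  have hL0 : (0 : ℝ) < F.L := by linarith
  have hl2 : l + 2 ≤ (F.P K).m + (F.P K).K := by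
    show l + 2 ≤ F.m + K
    have := F.hm
    omega
  have hd : (F.P K).d = 3 := T3Family.P_d F K
  have hLn : ((F.P K).L : ℝ) = F.L := rfl
  have ha₀ : 0 < regThreshold F n K ε₀ := regThreshold_pos F hε₀
  -- the level read `p := Lˡ·s_B ≤ 18ε₀∕L`
  have hp : ((F.P K).L : ℝ) ^ l * (2 * (((F.P K).d : ℝ) * (3 * ((F.P K).L : ℝ) ^ (l + 1) - 1)) * regThreshold F n K ε₀) ≤ 18 * ε₀ / F.L := by
    rw [hd, hLn]
    unfold regThreshold
    push_cast
    exact level_read_le hL1 hε₀.le hl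
  have hp0 : 0 ≤ ((F.P K).L : ℝ) ^ l * (2 * (((F.P K).d : ℝ) * (3 * ((F.P K).L : ℝ) ^ (l + 1) - 1)) * regThreshold F n K ε₀) := by
    rw [hLn]
    have h3 : (0 : ℝ) ≤ 3 * (F.L : ℝ) ^ (l + 1) - 1 := by linarith [one_le_pow₀ (M₀ := ℝ) (n := l + 1) hL1]
    have : (0 : ℝ) ≤ ((F.P K).d : ℝ) := Nat.cast_nonneg _
    have := ha₀.le
    positivity
  refine ⟨hl2, ha₀, by positivity, radius_member hL0 hsL, ?_, ?_, ?_⟩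
  · have h := budget_member hL3 hε₀.le hε hp0 hp
    have e : 6400 * ((((F.P K).d + 2) * (F.P K).L : ℕ) : ℝ) ^ 2 * ((F.P K).L : ℝ) ^ l *
        (2 * (((F.P K).d : ℝ) * (3 * ((F.P K).L : ℝ) ^ (l + 1) - 1)) * regThreshold F n K ε₀)
        = 6400 * (5 * (F.L : ℝ)) ^ 2 * (((F.P K).L : ℝ) ^ l * (2 * (((F.P K).d : ℝ) * (3 * ((F.P K).L : ℝ) ^ (l + 1) - 1)) * regThreshold F n K ε₀)) := by
      rw [hd]; push_cast; rw [hLn]; ring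
    rw [e]; exact h
  · have h := window_member hL3 hε₀.le hε hp
    have e : 1000 * ((((F.P K).d + 2) * (F.P K).L : ℕ) : ℝ) *
        (2 * (30 * ((((F.P K).d + 2) * (F.P K).L : ℕ) : ℝ) * ((F.P K).L : ℝ) ^ l *
          (2 * (((F.P K).d : ℝ) * (3 * ((F.P K).L : ℝ) ^ (l + 1) - 1)) * regThreshold F n K ε₀)) + 3 * (30000 * (F.L : ℝ))⁻¹)
        = 1000 * (5 * (F.L : ℝ)) * (2 * (30 * (5 * (F.L : ℝ)) * (((F.P K).L : ℝ) ^ l *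
            (2 * (((F.P K).d : ℝ) * (3 * ((F.P K).L : ℝ) ^ (l + 1) - 1)) * regThreshold F n K ε₀))) + 3 * (30000 * (F.L : ℝ))⁻¹) := by
      rw [hd]; push_cast; rw [hLn]; ring
    rw [e]; exact h
  · have hq0 : 0 ≤ 30 * (5 * (F.L : ℝ)) * (((F.P K).L : ℝ) ^ l * (2 * (((F.P K).d : ℝ) * (3 * ((F.P K).L : ℝ) ^ (l + 1) - 1)) * regThreshold F n K ε₀)) := by
      positivity
    have hq : 30 * (5 * (F.L : ℝ)) * (((F.P K).L : ℝ) ^ l * (2 * (((F.P K).d : ℝ) * (3 * ((F.P K).L : ℝ) ^ (l + 1) - 1)) * regThreshold F n K ε₀)) ≤ 2700 * ε₀ := by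
      have h := mul_le_mul_of_nonneg_left hp (by positivity : (0 : ℝ) ≤ 30 * (5 * (F.L : ℝ)))
      have e : 30 * (5 * (F.L : ℝ)) * (18 * ε₀ / F.L) = 2700 * ε₀ := by field_simp; ring
      linarith
    have hC := constant_member hL3 hε₀.le hε hq0 hq
    have e : 80 * (((F.P K).L : ℝ) * (3 * (30000 * (F.L : ℝ))⁻¹) + 22100 * ((((F.P K).d + 2) * (F.P K).L : ℕ) : ℝ) ^ 2 *
            ((30 * ((((F.P K).d + 2) * (F.P K).L : ℕ) : ℝ) * ((F.P K).L : ℝ) ^ l * (2 * (((F.P K).d : ℝ) * (3 * ((F.P K).L : ℝ) ^ (l + 1) - 1)) * regThreshold F n K ε₀)) +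
              ((30 * ((((F.P K).d + 2) * (F.P K).L : ℕ) : ℝ) * ((F.P K).L : ℝ) ^ l * (2 * (((F.P K).d : ℝ) * (3 * ((F.P K).L : ℝ) ^ (l + 1) - 1)) * regThreshold F n K ε₀)) +
                3 * (30000 * (F.L : ℝ))⁻¹)) ^ 2) / ((30000 * (F.L : ℝ))⁻¹) ^ 2 * (2 * ((F.P K).d : ℝ))
        = 80 * ((F.L : ℝ) * (3 * (30000 * (F.L : ℝ))⁻¹) + 22100 * (5 * (F.L : ℝ)) ^ 2 *
            ((30 * (5 * (F.L : ℝ)) * (((F.P K).L : ℝ) ^ l * (2 * (((F.P K).d : ℝ) * (3 * ((F.P K).L : ℝ) ^ (l + 1) - 1)) * regThreshold F n K ε₀))) +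
              ((30 * (5 * (F.L : ℝ)) * (((F.P K).L : ℝ) ^ l * (2 * (((F.P K).d : ℝ) * (3 * ((F.P K).L : ℝ) ^ (l + 1) - 1)) * regThreshold F n K ε₀))) +
                3 * (30000 * (F.L : ℝ))⁻¹)) ^ 2) / ((30000 * (F.L : ℝ))⁻¹) ^ 2 * (2 * 3) := by
      rw [hd]; push_cast; rw [hLn]; ring
    rw [e]
    exact hC

/-! ## §3 The member reading -/

/-- ★★★ **F1″-COV AT THE MEMBER, k-UNIFORM**: for a member `(F, n, K)` of the `d = 3` family, a printed-regular background `RegPr F n K ε₀ U₀` with `10⁷L³ε₀ ≤ 1`, a level `l + 1 ≤ K − n`,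
and an exponent field `y` on the level-`l` bonds with `‖y b‖ ≤ s`, `10⁵·L·s ≤ 1`: the one-step covariant defect of the (A′) tower at level `l`, summed over the level-`(l+1)` bonds, is
`≤ 10⁹·L⁴·Σ_b ‖y b‖²` — routeR-w6's ✓`sum_norm_chart_sub_fderiv_le_of_plaqSmall` at `a₀ := ε₀L^{−2(K−n)}` (✓`RegPr.plaqSmall`), Cauchy radius `R := (30000L)⁻¹`, both budgets paid by the one
window (§2), background letter `Ū₀ˡ = emlIterU l (bgUnits F K U₀)`.  The `hr`-row of ✓`jointRow_of_levelMasses` for P-A2 with `C_D = 10⁹L⁴`, L-only.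
[cite: Balaban1985Variational, (2) p.278, (44)-(46) p.285, (146) p.301; Balaban1985Averaging, (89) p.31, (121)-(125) p.36, (161)-(163) p.42] -/
theorem sum_norm_chart_sub_fderiv_le_of_regPr {ε₀ : ℝ} (hε : 10 ^ 7 * (F.L : ℝ) ^ 3 * ε₀ ≤ 1)
    {U₀ : GaugeField (F.P K) 0 (Matrix.specialUnitaryGroup (Fin 2) ℂ)} (hreg : RegPr F n K ε₀ U₀) {l : ℕ} (hl : l + 1 ≤ K - n)
    {s : ℝ} (hs : 0 ≤ s) (hsL : 100000 * (F.L : ℝ) * s ≤ 1)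
    {y : PBond (F.P K) l → Matrix (Fin 2) (Fin 2) ℂ} (hy : ∀ b : PBond (F.P K) l, ‖y b‖ ≤ s) :
    ∑ c : PBond (F.P K) (l + 1), ‖mlog (((dbarCovU (emlIterU l (bgUnits F K U₀)) (fun b => expUnit (y b) * emlIterU l (bgUnits F K U₀) b) c :
            (Matrix (Fin 2) (Fin 2) ℂ)ˣ) : Matrix (Fin 2) (Fin 2) ℂ) *
          (((emlAvgU (emlIterU l (bgUnits F K U₀)) c)⁻¹ : (Matrix (Fin 2) (Fin 2) ℂ)ˣ) : Matrix (Fin 2) (Fin 2) ℂ)) -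
        fderiv ℂ (fun y : PBond (F.P K) l → Matrix (Fin 2) (Fin 2) ℂ =>
          mlog (((dbarCovU (emlIterU l (bgUnits F K U₀)) (fun b => expUnit (y b) * emlIterU l (bgUnits F K U₀) b) c :
              (Matrix (Fin 2) (Fin 2) ℂ)ˣ) : Matrix (Fin 2) (Fin 2) ℂ) *
            (((emlAvgU (emlIterU l (bgUnits F K U₀)) c)⁻¹ : (Matrix (Fin 2) (Fin 2) ℂ)ˣ) : Matrix (Fin 2) (Fin 2) ℂ))) 0 y‖ ≤
      10 ^ 9 * (F.L : ℝ) ^ 4 * ∑ b : PBond (F.P K) l, ‖y b‖ ^ 2 := by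
  rw [show bgUnits F K U₀ = unitsField (toUField U₀) from rfl]
  obtain ⟨hl2, ha₀, hR, hsR, hbud₀, hwin, hC⟩ := member_rows (F := F) (n := n) (K := K) hε hreg hl hsL
  exact (sum_norm_chart_sub_fderiv_le_of_plaqSmall (P := F.P K) hl2 U₀ ha₀ hreg.plaqSmall hR hs hsR hbud₀ hwin hy).trans
    (mul_le_mul_of_nonneg_right hC (Finset.sum_nonneg fun b _ => sq_nonneg _))

/-- ★★★ **THE SAME IN THE FIELD-VALUED LETTER** (the shape F0″'s ✓`IteratedMapTelescope` and the F4″ knit consume: `fderiv` of the field-valued chart `y ↦ (c ↦ f_l(y)(c))`, evaluated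
at `c`): `Σ_c ‖f_l(y)(c) − (fderiv ℂ (fun y c ↦ f_l(y)(c)) 0 y) c‖ ≤ 10⁹·L⁴·Σ_b ‖y b‖²` — routeR-w6's ✓`sum_norm_chartField_sub_fderiv_apply_le_of_plaqSmall` at the member, same rows.
[cite: Balaban1985Variational, (2) p.278, (44)-(46) p.285, (146) p.301; Balaban1985Averaging, (89) p.31, (121)-(125) p.36] -/
theorem sum_norm_chartField_sub_fderiv_apply_le_of_regPr {ε₀ : ℝ} (hε : 10 ^ 7 * (F.L : ℝ) ^ 3 * ε₀ ≤ 1)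
    {U₀ : GaugeField (F.P K) 0 (Matrix.specialUnitaryGroup (Fin 2) ℂ)} (hreg : RegPr F n K ε₀ U₀) {l : ℕ} (hl : l + 1 ≤ K - n)
    {s : ℝ} (hs : 0 ≤ s) (hsL : 100000 * (F.L : ℝ) * s ≤ 1)
    {y : PBond (F.P K) l → Matrix (Fin 2) (Fin 2) ℂ} (hy : ∀ b : PBond (F.P K) l, ‖y b‖ ≤ s) :
    ∑ c : PBond (F.P K) (l + 1), ‖mlog (((dbarCovU (emlIterU l (bgUnits F K U₀)) (fun b => expUnit (y b) * emlIterU l (bgUnits F K U₀) b) c :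
            (Matrix (Fin 2) (Fin 2) ℂ)ˣ) : Matrix (Fin 2) (Fin 2) ℂ) *
          (((emlAvgU (emlIterU l (bgUnits F K U₀)) c)⁻¹ : (Matrix (Fin 2) (Fin 2) ℂ)ˣ) : Matrix (Fin 2) (Fin 2) ℂ)) -
        fderiv ℂ (fun (y : PBond (F.P K) l → Matrix (Fin 2) (Fin 2) ℂ) (c : PBond (F.P K) (l + 1)) =>
          mlog (((dbarCovU (emlIterU l (bgUnits F K U₀)) (fun b => expUnit (y b) * emlIterU l (bgUnits F K U₀) b) c :
              (Matrix (Fin 2) (Fin 2) ℂ)ˣ) : Matrix (Fin 2) (Fin 2) ℂ) *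
            (((emlAvgU (emlIterU l (bgUnits F K U₀)) c)⁻¹ : (Matrix (Fin 2) (Fin 2) ℂ)ˣ) : Matrix (Fin 2) (Fin 2) ℂ))) 0 y c‖ ≤
      10 ^ 9 * (F.L : ℝ) ^ 4 * ∑ b : PBond (F.P K) l, ‖y b‖ ^ 2 := by
  rw [show bgUnits F K U₀ = unitsField (toUField U₀) from rfl]
  obtain ⟨hl2, ha₀, hR, hsR, hbud₀, hwin, hC⟩ := member_rows (F := F) (n := n) (K := K) hε hreg hl hsL
  exact (sum_norm_chartField_sub_fderiv_apply_le_of_plaqSmall (P := F.P K) hl2 U₀ ha₀ hreg.plaqSmall hR hs hsR hbud₀ hwin hy).trans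
    (mul_le_mul_of_nonneg_right hC (Finset.sum_nonneg fun b _ => sq_nonneg _))

end Summit.QuantumFields.YangMills.Theorems.Prop7TwistedOneStepDefectOfRegPr

end
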